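import Literature.NumberTheory.QuadraticFields.ThreeTorsion
import Literature.NumberTheory.QuadraticFields.ScholzHeckeUnitCriterion
import Literature.NumberTheory.QuadraticFields.RealQuadraticRegulator
import Mathlib.NumberTheory.NumberField.DedekindZeta
import HarnessLib

/-!
# Tools for the torsion-witness test on the Scholz mirror field `ℚ(√3d)`

Topic `NumberTheory/QuadraticFields`, namespace `Literature.NumberTheory.QuadraticFields`. Theorem-only file
(no definitions, no named facts), written for the line `scholz-mirror-siegel` of the crux `IqThreeMemBQP`
(stmt-QuantumAdvantage-2424: deciding `3 ∣ h(−d)` in `BQP` through Scholz's mirror field `k = ℚ(√3d)`), whose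
real-side primitive samples an ideal `(a, r + √d₀)` of `k` and asks whether its class has order divisible by `3`.
With `d₀ = mirrorRadicand d` (the square-free kernel of `3d`, `ScholzHeckeUnitCriterion.lean`) and
`D⁺ = (if 3 ∣ d then d/3 else 3d)` the mirror discriminant, we prove:

* (a) **mirror data**: for `−d` a negative fundamental discriminant and `d ≠ 3`, `d₀` is square-free, `d₀ ≥ 2`
  and `fundDiscr d₀ = D⁺` (`mirrorRadicand_spec`), so `D⁺ > 0` is the discriminant of `ℚ(√d₀)`
  (`exists_numberField_discr_eq_mirrorDisc`), and every quadratic field of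
  discriminant `fundDiscr m` contains an integral `α` with `α² = m` (`exists_ringOfIntegers_sq_eq`);
* (b) **soundness of the test**: if `#Cl(K)[3] = 1` (`quadFieldThreeTorsion D = 1`) no ideal class of `K` has
  order divisible by `3` (`not_three_dvd_orderOf_of_torsion_eq_one`, Cauchy);
* (c) **`3 ∣ h_K` when `#Cl(K)[3] ≠ 1`** (`three_dvd_card_classGroup_of_torsion_ne_one`, Cauchy), so that the
  torsion statistic of `Literature/GroupTheory/FiniteAbelian/TorsionWitnessStatistic.lean` (at least two thirds of the
  classes have order divisible by `3`) applies to `Cl(K)` — that statistic is NOT re-proved here;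
* (d) **the residue of a real quadratic field**: `κ_F = 2 h_F R_F/√d_F` (`dedekindZeta_residue_eq_of_discr_pos`,
  Mathlib's class number formula with `(r₁, r₂) = (2, 0)`, `w_F = 2`), so a lower bound `κ_F ≥ c/L` is the bound
  `h_F R_F ≥ c√d_F/(2L)` (`classNumber_mul_regulator_ge_of_residue_ge`);
* (f) **model independence of `ord[(a, r + α)]`**: two quadratic fields `F ∋ α`, `F' ∋ α'` with
  `α² = α'² = m` are isomorphic by `e` with `e α = α'` (`exists_algEquiv_apply_eq_of_sq_eq`, through Mathlib's
  model `QuadraticAlgebra ℚ m 0` and `QuadraticAlgebra.lift`), and the order of an ideal class is invariant under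
  `Ideal.map` of a ring isomorphism (`orderOf_mk0_map_ringEquiv`, via `ClassGroup.mk0_eq_one_iff`), hence
  `ord[(a, r + α) ⊆ 𝓞 F] = ord[(a, r + α') ⊆ 𝓞 F']` (`orderOf_mk0_span_pair_eq_of_sq_eq`).

## References

* A. Scholz, *Über die Beziehung der Klassenzahlen quadratischer Körper zueinander*, J. reine angew. Math. 166
  (1932) 201–203 (the mirror pair `ℚ(√−d)`, `ℚ(√3d)`). [Scholz1932]
* H. Cohen, *A Course in Computational Algebraic Number Theory*, GTM 138 (1993), §5.1–5.2 (fundamental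
  discriminants, `ℚ(√m)` and its discriminant), §4.9 (class group, class number formula). [Cohen1993]
* D. A. Marcus, *Number Fields*, 2nd ed. (2018), Ch. 2 (quadratic fields `ℚ(√m)`, integral bases). [Marcus2018]
-/

namespace Literature.NumberTheory.QuadraticFields

open scoped NumberField nonZeroDivisors

/-! ### (a) The mirror radicand and the mirror discriminant -/

/-- Unpacking `IsNegFundamentalDiscr d` over `ℕ`: `d ≡ 3 (mod 4)` squarefree, or `d = 4k` with
`k ≡ 1, 2 (mod 4)` squarefree. [folklore] -/
theorem isNegFundamentalDiscr_cases {d : ℕ} (hd : (((-(d:ℤ)) % 4 = 1 ∧ Squarefree (-(d:ℤ)) ∧ (-(d:ℤ)) ≠ 1) ∨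
      (4 ∣ (-(d:ℤ)) ∧ ((-(d:ℤ)) / 4 % 4 = 2 ∨ (-(d:ℤ)) / 4 % 4 = 3) ∧ Squarefree ((-(d:ℤ)) / 4)))) :
    (d % 4 = 3 ∧ Squarefree d) ∨ (∃ k : ℕ, d = 4 * k ∧ (k % 4 = 1 ∨ k % 4 = 2) ∧ Squarefree k) := by
  rcases hd with ⟨h1, hsf, -⟩ | ⟨h4, hres, hsf⟩
  · left
    refine ⟨by omega, ?_⟩
    rwa [← Int.squarefree_natAbs, Int.natAbs_neg, Int.natAbs_natCast] at hsf
  · right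
    obtain ⟨k, rfl⟩ : ∃ k : ℕ, d = 4 * k := ⟨d / 4, by omega⟩
    have hq : (-((4 * k : ℕ) : ℤ)) / 4 = -(k : ℤ) := by push_cast; omega
    rw [hq] at hres hsf
    refine ⟨k, rfl, by omega, ?_⟩
    rwa [← Int.squarefree_natAbs, Int.natAbs_neg, Int.natAbs_natCast] at hsf

/-- **The mirror radicand on the promise.** For `−d` fundamental and `d ≠ 3`, `d₀ = mirrorRadicand d`
(the square-free kernel of `3d`) is squarefree, `d₀ ≥ 2`, and the (fundamental) discriminant of
`ℚ(√d₀)` is the mirror discriminant `D⁺ = (if 3 ∣ d then d/3 else 3d)`: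
`Quadratic.fundDiscr d₀ = D⁺`. (Four cases: `d ≡ 3 (4)` or `d = 4k`, times `3 ∣ d` or not.) [folklore] -/
theorem mirrorRadicand_spec {d : ℕ} (hd : (((-(d:ℤ)) % 4 = 1 ∧ Squarefree (-(d:ℤ)) ∧ (-(d:ℤ)) ≠ 1) ∨
      (4 ∣ (-(d:ℤ)) ∧ ((-(d:ℤ)) / 4 % 4 = 2 ∨ (-(d:ℤ)) / 4 % 4 = 3) ∧ Squarefree ((-(d:ℤ)) / 4)))) (hd3 : d ≠ 3) :
    Squarefree (mirrorRadicand d) ∧ 2 ≤ mirrorRadicand d ∧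
      Quadratic.fundDiscr (mirrorRadicand d) = (if 3 ∣ d then ((d / 3 : ℕ) : ℤ) else 3 * (d : ℤ)) := by
  have h3sf : Squarefree (3 : ℕ) := Nat.prime_three.prime.squarefree
  rcases isNegFundamentalDiscr_cases hd with ⟨hd4, hsf⟩ | ⟨k, rfl, hk, hsf⟩
  · -- odd case: `d ≡ 3 (mod 4)`
    have hnd4 : ¬ 4 ∣ d := by omega
    by_cases h3 : 3 ∣ d
    · obtain ⟨j, rfl⟩ := h3
      have h3' : 3 ∣ 3 * j := dvd_mul_right 3 j
      have hj : mirrorRadicand (3 * j) = j := by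
        rw [mirrorRadicand, if_pos h3', if_neg hnd4]; omega
      rw [hj, if_pos h3', Nat.mul_div_cancel_left j (by norm_num : 0 < 3)]
      exact ⟨hsf.of_mul_right, by omega, Quadratic.fundDiscr_of_mod_four_eq_one (by omega)⟩
    · have hj : mirrorRadicand d = 3 * d := by
        rw [mirrorRadicand, if_neg h3, if_neg hnd4]
      rw [hj, if_neg h3]
      have hcop : Nat.Coprime 3 d := (Nat.Prime.coprime_iff_not_dvd Nat.prime_three).2 h3
      refine ⟨(Nat.squarefree_mul hcop).2 ⟨h3sf, hsf⟩, by omega, ?_⟩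
      rw [Quadratic.fundDiscr_of_mod_four_eq_one (by omega)]; push_cast; ring
  · -- even case: `d = 4k`, `k ≡ 1, 2 (mod 4)`
    have h4 : 4 ∣ 4 * k := dvd_mul_right 4 k
    by_cases h3 : 3 ∣ 4 * k
    · obtain ⟨j, rfl⟩ : ∃ j, k = 3 * j := ⟨k / 3, by omega⟩
      have hj : mirrorRadicand (4 * (3 * j)) = j := by
        rw [mirrorRadicand, if_pos h3, if_pos h4]; omega
      rw [hj, if_pos h3]
      refine ⟨hsf.of_mul_right, by omega, ?_⟩
      rw [Quadratic.fundDiscr_of_mod_four_ne_one (by omega)]; push_cast; omega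
    · have hj : mirrorRadicand (4 * k) = 3 * k := by
        rw [mirrorRadicand, if_neg h3, if_pos h4]; omega
      rw [hj, if_neg h3]
      have h3k : ¬ 3 ∣ k := fun h => h3 (dvd_mul_of_dvd_right h 4)
      have hcop : Nat.Coprime 3 k := (Nat.Prime.coprime_iff_not_dvd Nat.prime_three).2 h3k
      refine ⟨(Nat.squarefree_mul hcop).2 ⟨h3sf, hsf⟩, by omega, ?_⟩
      rw [Quadratic.fundDiscr_of_mod_four_ne_one (by omega)]; push_cast; ring

/-- The mirror discriminant `D⁺` is a positive fundamental discriminant… in particular `D⁺ > 0`.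
[folklore] -/
theorem mirrorDisc_pos {d : ℕ} (hd : (((-(d:ℤ)) % 4 = 1 ∧ Squarefree (-(d:ℤ)) ∧ (-(d:ℤ)) ≠ 1) ∨
      (4 ∣ (-(d:ℤ)) ∧ ((-(d:ℤ)) / 4 % 4 = 2 ∨ (-(d:ℤ)) / 4 % 4 = 3) ∧ Squarefree ((-(d:ℤ)) / 4)))) (hd3 : d ≠ 3) :
    0 < (if 3 ∣ d then ((d / 3 : ℕ) : ℤ) else 3 * (d : ℤ)) := by
  obtain ⟨-, h2, hfd⟩ := mirrorRadicand_spec hd hd3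
  rw [← hfd]
  exact Quadratic.fundDiscr_pos (by omega)

/-- **"`ℚ(√d₀)` is a quadratic field of discriminant `D⁺`", existence half**: there is a quadratic
number field (in `Type`) of discriminant `D⁺ = (if 3 ∣ d then d/3 else 3d)`
(`Quadratic.isFundamental_fundDiscr`, `Quadratic.exists_numberField_discr_eq`). [folklore] -/
theorem exists_numberField_discr_eq_mirrorDisc {d : ℕ} (hd : (((-(d:ℤ)) % 4 = 1 ∧ Squarefree (-(d:ℤ)) ∧ (-(d:ℤ)) ≠ 1) ∨
      (4 ∣ (-(d:ℤ)) ∧ ((-(d:ℤ)) / 4 % 4 = 2 ∨ (-(d:ℤ)) / 4 % 4 = 3) ∧ Squarefree ((-(d:ℤ)) / 4)))) (hd3 : d ≠ 3) :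
    ∃ (F : Type) (_ : Field F) (_ : NumberField F), Module.finrank ℚ F = 2 ∧
      NumberField.discr F = (if 3 ∣ d then ((d / 3 : ℕ) : ℤ) else 3 * (d : ℤ)) := by
  obtain ⟨hsf, h2, hfd⟩ := mirrorRadicand_spec hd hd3
  rw [← hfd]
  exact Quadratic.exists_numberField_discr_eq (Quadratic.isFundamental_fundDiscr hsf h2)

/-- A quadratic field whose discriminant is `fundDiscr m` contains a square root of `m` in its ring of
integers (`δ² = d_F ∈ {m, 4m}` for the generator `δ` of `Quadratic.exists_not_mem_range_sq_eq_discr`;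
take `δ` or `δ/2`, integral as a root of `X² − m`). [folklore] -/
theorem exists_ringOfIntegers_sq_eq {F : Type*} [Field F] [NumberField F]
    (h2 : Module.finrank ℚ F = 2) {m : ℕ} (hdisc : NumberField.discr F = Quadratic.fundDiscr m) :
    ∃ α : 𝓞 F, (α : F) ^ 2 = (m : F) := by
  obtain ⟨δ, -, hδ⟩ := Quadratic.exists_not_mem_range_sq_eq_discr h2
  rw [map_intCast, hdisc] at hδ
  obtain ⟨β, hβ⟩ : ∃ β : F, β ^ 2 = (m : F) := by
    by_cases hm : m % 4 = 1
    · exact ⟨δ, by rw [hδ, Quadratic.fundDiscr_of_mod_four_eq_one hm, Int.cast_natCast]⟩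
    · refine ⟨δ / 2, ?_⟩
      rw [div_pow, hδ, Quadratic.fundDiscr_of_mod_four_ne_one hm]
      push_cast
      ring
  have hint : IsIntegral ℤ β := by
    refine IsIntegral.of_pow (by norm_num : 0 < 2) ?_
    have h := isIntegral_algebraMap (R := ℤ) (A := F) (x := (m : ℤ))
    rwa [eq_intCast, Int.cast_natCast, ← hβ] at h
  exact ⟨⟨β, hint⟩, hβ⟩

/-- The ideal `(a, β)` of `𝓞 F` is non-zero for `a > 0` (it contains `a ≠ 0`), i.e. a non-zero-divisor of
the ideal semiring — the binder `hI` of the hypothesis is always inhabited. [folklore] -/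
theorem span_pair_natCast_mem_nonZeroDivisors {F : Type*} [Field F] [NumberField F] {a : ℕ} (ha : 0 < a)
    (β : 𝓞 F) : Ideal.span {(a : 𝓞 F), β} ∈ (Ideal (𝓞 F))⁰ := by
  rw [mem_nonZeroDivisors_iff_ne_zero, Ne, Ideal.zero_eq_bot, Ideal.span_eq_bot]
  intro h
  exact (Nat.cast_ne_zero.2 ha.ne') (h (a : 𝓞 F) (Set.mem_insert _ _))

/-! ### (b) Soundness algebra: no witness when `#Cl₃(D⁺) = 1` -/

/-- **Soundness algebra.** If `quadFieldThreeTorsion D = 1` then in every quadratic field `K` of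
discriminant `D` no ideal class has order divisible by `3` (`quadFieldThreeTorsion_eq`: `#Cl(K)[3] = 1`;
Cauchy: `3 ∣ ord g ∣ h_K` would give a class of order `3`). [folklore] -/
theorem not_three_dvd_orderOf_of_torsion_eq_one {D : ℤ} (hD : quadFieldThreeTorsion D = 1)
    (K : Type*) [Field K] [NumberField K] (h2 : Module.finrank ℚ K = 2) (hdisc : NumberField.discr K = D)
    (g : ClassGroup (𝓞 K)) : ¬ 3 ∣ orderOf g := by
  intro h3
  have hcard : 3 ∣ Nat.card (ClassGroup (𝓞 K)) := h3.trans (orderOf_dvd_natCard g)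
  have h1 := (one_lt_natCard_pow_three_eq_one_iff (ClassGroup (𝓞 K))).2 hcard
  rw [← quadFieldThreeTorsion_eq D K h2 hdisc, hD] at h1
  exact lt_irrefl 1 h1

/-! ### (c) `3 ∣ h_K` on the yes side (the statistic itself: `TorsionWitnessStatistic.lean`) -/

/-- **Completeness algebra on the yes side**: if `#Cl₃(D) ≠ 1` then `3 ∣ h_K` for every quadratic `K` of
discriminant `D` (`quadFieldThreeTorsion_eq`, `quadFieldThreeTorsion_pos`, Cauchy), so the torsion
statistic applies to `Cl(K)`. [folklore] -/
theorem three_dvd_card_classGroup_of_torsion_ne_one {D : ℤ} (hD : quadFieldThreeTorsion D ≠ 1)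
    (K : Type*) [Field K] [NumberField K] (h2 : Module.finrank ℚ K = 2) (hdisc : NumberField.discr K = D) :
    3 ∣ Fintype.card (ClassGroup (𝓞 K)) := by
  have hpos := quadFieldThreeTorsion_pos D
  have h1 : 1 < quadFieldThreeTorsion D := by omega
  rw [quadFieldThreeTorsion_eq D K h2 hdisc, one_lt_natCard_pow_three_eq_one_iff,
    Nat.card_eq_fintype_card] at h1
  exact h1

/-! ### (d) Brightness in class-number currency: the residue of a real quadratic field -/

/-- **`κ_F = 2 h_F R_F / √d_F` for a real quadratic field** (Mathlib's class-number-formula definition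
`NumberField.dedekindZeta_residue` with `r₁ = 2`, `r₂ = 0`, `w = 2`:
`Quadratic.nrRealPlaces_eq_two_and_nrComplexPlaces_eq_zero`, `Quadratic.torsionOrder_eq_two_of_discr_pos`).
So brightness `κ_F ≥ c/log d` reads `h_F R_F ≥ c √D⁺/(2 log d)`, and the per-class main term of the
ideal count, `κ_F Y / h_F = 2 R_F Y/√D⁺`, is class-independent. [folklore] -/
theorem dedekindZeta_residue_eq_of_discr_pos (F : Type*) [Field F] [NumberField F]
    (h2 : Module.finrank ℚ F = 2) (hd : 0 < NumberField.discr F) :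
    NumberField.dedekindZeta_residue F =
      2 * NumberField.Units.regulator F * NumberField.classNumber F / Real.sqrt (NumberField.discr F) := by
  obtain ⟨hr, hc⟩ := Quadratic.nrRealPlaces_eq_two_and_nrComplexPlaces_eq_zero h2 hd
  rw [NumberField.dedekindZeta_residue_def, hr, hc, Quadratic.torsionOrder_eq_two_of_discr_pos h2 hd]
  have habs : |(NumberField.discr F : ℝ)| = NumberField.discr F := abs_of_pos (by exact_mod_cast hd)
  rw [habs, show ((2 : ℕ) : ℝ) = 2 by norm_num]
  ring

/-- Brightness in class-number currency: `c / log d ≤ κ_F` gives `c √d_F / (2 log d) ≤ h_F R_F`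
when `log d > 0`. [folklore] -/
theorem classNumber_mul_regulator_ge_of_residue_ge (F : Type*) [Field F] [NumberField F]
    (h2 : Module.finrank ℚ F = 2) (hd : 0 < NumberField.discr F) {c L : ℝ} (hL : 0 < L)
    (hc : c / L ≤ NumberField.dedekindZeta_residue F) :
    c * Real.sqrt (NumberField.discr F) / (2 * L) ≤
      NumberField.classNumber F * NumberField.Units.regulator F := by
  rw [dedekindZeta_residue_eq_of_discr_pos F h2 hd] at hc
  have hs : 0 < Real.sqrt (NumberField.discr F) := Real.sqrt_pos.2 (by exact_mod_cast hd)
  rw [div_le_iff₀ hL] at hc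
  rw [div_le_iff₀ (by positivity)]
  calc c * Real.sqrt (NumberField.discr F)
      ≤ 2 * NumberField.Units.regulator F * NumberField.classNumber F / Real.sqrt (NumberField.discr F) * L *
          Real.sqrt (NumberField.discr F) := by
        exact mul_le_mul_of_nonneg_right hc hs.le
    _ = NumberField.classNumber F * NumberField.Units.regulator F * (2 * L) := by
        field_simp

/-! ### (f) Model independence of `ord[(a, r + α)]` (for the S5 prover: the good-output set is nonempty) -/

/-- A quadratic extension `K = F(θ)`, `θ² = c`, `θ ∉ F`, is `F`-isomorphic to Mathlib's model
`QuadraticAlgebra F c 0` BY AN ISOMORPHISM SENDING `ω ↦ θ` (the tree's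
`Quadratic.nonempty_algEquiv_quadraticAlgebra`, keeping track of the generator: `QuadraticAlgebra.lift`).
[folklore] -/
theorem exists_algEquiv_quadraticAlgebra_apply_omega {F K : Type*} [Field F] [Field K] [Algebra F K]
    (h2 : Module.finrank F K = 2) {θ : K} {c : F}
    (hθ : θ ∉ Set.range (algebraMap F K)) (hc : θ ^ 2 = algebraMap F K c) :
    ∃ e : QuadraticAlgebra F c 0 ≃ₐ[F] K, e QuadraticAlgebra.omega = θ := by
  haveI := Quadratic.fact_sq_ne_of_sq_eq hθ hc
  haveI : FiniteDimensional F K := Module.finite_of_finrank_pos (by rw [h2]; exact two_pos)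
  let u : {u : K // u * u = c • 1 + (0 : F) • u} :=
    ⟨θ, by rw [zero_smul, add_zero, ← sq, hc, Algebra.algebraMap_eq_smul_one]⟩
  let f : QuadraticAlgebra F c 0 →ₐ[F] K := QuadraticAlgebra.lift u
  have hinj : Function.Injective f := f.toRingHom.injective
  have hdim : Module.finrank F (QuadraticAlgebra F c 0) = Module.finrank F K := by
    rw [QuadraticAlgebra.finrank_eq_two, h2]
  have hsurj : Function.Surjective f :=
    (LinearMap.injective_iff_surjective_of_finrank_eq_finrank hdim (f := f.toLinearMap)).mp hinj
  refine ⟨AlgEquiv.ofBijective f ⟨hinj, hsurj⟩, ?_⟩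
  change f QuadraticAlgebra.omega = θ
  simp [f, u, QuadraticAlgebra.lift_apply_apply, QuadraticAlgebra.omega_re, QuadraticAlgebra.omega_im]

/-- **Two models of `ℚ(√m)` are isomorphic by an isomorphism matching the chosen square roots**: for
quadratic number fields `F ∋ α`, `F' ∋ α'` with `α² = α'² = m` (`m ≥ 2` squarefree) there is
`e : F ≃ₐ[ℚ] F'` with `e α = α'`. [folklore] -/
theorem exists_algEquiv_apply_eq_of_sq_eq {F F' : Type*} [Field F] [NumberField F] [Field F']
    [NumberField F'] (h2 : Module.finrank ℚ F = 2) (h2' : Module.finrank ℚ F' = 2) {m : ℕ}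
    (hsf : Squarefree m) (hm : 2 ≤ m) {α : F} {α' : F'} (hα : α ^ 2 = (m : F))
    (hα' : α' ^ 2 = (m : F')) : ∃ e : F ≃ₐ[ℚ] F', e α = α' := by
  have hθ := Quadratic.not_mem_range_of_sq_eq_natCast hsf hm hα
  have hθ' := Quadratic.not_mem_range_of_sq_eq_natCast hsf hm hα'
  have hc : α ^ 2 = algebraMap ℚ F (m : ℚ) := by rw [hα, map_natCast]
  have hc' : α' ^ 2 = algebraMap ℚ F' (m : ℚ) := by rw [hα', map_natCast]
  obtain ⟨e, he⟩ := exists_algEquiv_quadraticAlgebra_apply_omega h2 hθ hc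
  obtain ⟨e', he'⟩ := exists_algEquiv_quadraticAlgebra_apply_omega h2' hθ' hc'
  refine ⟨e.symm.trans e', ?_⟩
  rw [AlgEquiv.trans_apply, ← he, AlgEquiv.symm_apply_apply, he']

/-- Along a ring isomorphism, an ideal is principal iff its image is (principal ideals stay principal
under ring homomorphisms, `(x) ↦ (f x)`: Mathlib's instance `instIsPrincipalMapRingHom`; dedup-02391).
[folklore] -/
theorem isPrincipal_map_iff {R S : Type*} [CommRing R] [CommRing S] (g : R ≃+* S) (J : Ideal R) :
    (J.map (g : R →+* S)).IsPrincipal ↔ J.IsPrincipal := by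
  refine ⟨fun h => ?_, fun h => instIsPrincipalMapRingHom _ J⟩
  have := instIsPrincipalMapRingHom (g.symm : S →+* R) (J.map (g : R →+* S))
  rwa [Ideal.map_of_equiv] at this

/-- **The order of an ideal class is invariant under ring isomorphisms of the ring of integers**
(intrinsic form avoiding `ClassGroup.mulEquiv`: `ord[I]` is the least `n ≥ 1` with `Iⁿ` principal,
`ClassGroup.mk0_eq_one_iff`, and principality of `Iⁿ` is transported by `Ideal.map`). [folklore] -/
theorem orderOf_mk0_map_ringEquiv {R S : Type*} [CommRing R] [IsDedekindDomain R] [CommRing S]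
    [IsDedekindDomain S] (g : R ≃+* S) (I : Ideal R) (hI : I ∈ (Ideal R)⁰)
    (hI' : I.map (g : R →+* S) ∈ (Ideal S)⁰) :
    orderOf (ClassGroup.mk0 ⟨I.map (g : R →+* S), hI'⟩) = orderOf (ClassGroup.mk0 ⟨I, hI⟩) := by
  rw [orderOf_eq_orderOf_iff]
  intro n
  rw [← map_pow, ← map_pow, SubmonoidClass.mk_pow, SubmonoidClass.mk_pow, ClassGroup.mk0_eq_one_iff,
    ClassGroup.mk0_eq_one_iff, ← Ideal.map_pow, isPrincipal_map_iff]

/-- **Model independence of `ord[(a, r + α)]`.** For two quadratic number fields `F ∋ α`, `F' ∋ α'` with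
`α² = α'² = m` (`m ≥ 2` squarefree) and any `a, r`, the classes of `(a, r + α) ⊆ 𝓞 F` and
`(a, r + α') ⊆ 𝓞 F'` have the same order: the isomorphism `e : F ≃ F'`, `e α = α'`
(`exists_algEquiv_apply_eq_of_sq_eq`) restricts to `𝓞 F ≃+* 𝓞 F'` (`RingOfIntegers.mapRingEquiv`) and maps
the one ideal onto the other. Consequently the good-output set of the S5 relation on a valid instance is
`{⟨bin N, t⟩ : t}` for ONE number `N` — nonempty. (The case `α' = −α` in the same field is included:
take `F' = F`.) [folklore] -/
theorem orderOf_mk0_span_pair_eq_of_sq_eq {F F' : Type*} [Field F] [NumberField F] [Field F']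
    [NumberField F'] (h2 : Module.finrank ℚ F = 2) (h2' : Module.finrank ℚ F' = 2) {m : ℕ}
    (hsf : Squarefree m) (hm : 2 ≤ m) {α : 𝓞 F} {α' : 𝓞 F'} (hα : (α : F) ^ 2 = (m : F))
    (hα' : (α' : F') ^ 2 = (m : F')) (a r : ℕ)
    (hI : Ideal.span {(a : 𝓞 F), (r : 𝓞 F) + α} ∈ (Ideal (𝓞 F))⁰)
    (hI' : Ideal.span {(a : 𝓞 F'), (r : 𝓞 F') + α'} ∈ (Ideal (𝓞 F'))⁰) :
    orderOf (ClassGroup.mk0 ⟨_, hI⟩) = orderOf (ClassGroup.mk0 ⟨_, hI'⟩) := by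
  obtain ⟨e, he⟩ := exists_algEquiv_apply_eq_of_sq_eq h2 h2' hsf hm hα hα'
  set g : 𝓞 F ≃+* 𝓞 F' := NumberField.RingOfIntegers.mapRingEquiv e.toRingEquiv with hg
  have hgα : g α = α' := by
    apply NumberField.RingOfIntegers.ext
    rw [hg, NumberField.RingOfIntegers.mapRingEquiv_apply]
    exact he
  have hmap : (Ideal.span {(a : 𝓞 F), (r : 𝓞 F) + α}).map (g : 𝓞 F →+* 𝓞 F') =
      Ideal.span {(a : 𝓞 F'), (r : 𝓞 F') + α'} := by
    rw [Ideal.map_span, Set.image_insert_eq, Set.image_singleton]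
    simp only [RingHom.coe_coe, map_natCast, map_add, hgα]
  have hI'' : (Ideal.span {(a : 𝓞 F), (r : 𝓞 F) + α}).map (g : 𝓞 F →+* 𝓞 F') ∈ (Ideal (𝓞 F'))⁰ := by
    rw [hmap]; exact hI'
  rw [← orderOf_mk0_map_ringEquiv g _ hI hI'']
  congr 3

end Literature.NumberTheory.QuadraticFields
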